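import Mathlib
import Literature.Combinatorics.Optimization.CorrelationPolytopeGridMinor
import Literature.Barriers.PneNP.ExtendedFormulationMinkowskiFaces
import Literature.Barriers.PneNP.CorrelationPolytopeXCLowerBoundGraph
import Summits.ValiantsHypothesis.ValiantsHypothesis.Theorems.FifoMatchingXcDivisionZmixDefs

/-!
# Sketch — val-idea-38 g0 (WAVE-4, crux stmt-ValiantsHypothesis-21181, residual COR-MINKOWSKI)

Card `pairing-face-exposure`: the PAIRING (non-root contraction) FACE certificate.  Statements only (planner;
nothing here is proved except the two finite sanity checks at `m = 3`).  VP ≠ VNP NOT proved; `NNDivisionHard`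
NOT proved; COR-MINKOWSKI (∀ Q) NOT decided — the card decides the passenger `Z_mix` at EXPONENTIAL rate and a
Q-uniform class (`PairingExposureLaw`).
-/

set_option autoImplicit false
set_option linter.dupNamespace false

noncomputable section

open Matrix Finset
open scoped Pointwise

namespace Summit.ValiantsHypothesis.ValiantsHypothesis.Cruxes.NNDivisionHard.PairFace

open Literature.Barriers.PneNP (HasEFOfSize)
open Literature.Combinatorics.Optimization (corPolytopeGraph corVec)
open Summit.ValiantsHypothesis.ValiantsHypothesis.Theorems.FifoMatching.XcDivision (Zmix zmixDir zmixPt zmixArgmax)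

variable {m : ℕ}

/-- even slot `2i` of block `i`. -/
def ev (i : Fin m) : Fin (2 * m) := ⟨2 * i.1, by omega⟩

/-- odd slot `2i+1` of block `i`. -/
def od (i : Fin m) : Fin (2 * m) := ⟨2 * i.1 + 1, by omega⟩

/-- the block `⌊p/2⌋` of a slot. -/
def blk (p : Fin (2 * m)) : Fin m := ⟨p.1 / 2, by omega⟩

/-- the parity sign of a slot (`+1` even, `−1` odd). -/
def sgn (p : Fin (2 * m)) : ℝ := if p.1 % 2 = 0 then 1 else -1

/-- exponent of the cross weight `w_{ij} = 2^{wExp i j}`: symmetric in `i, j`, injective on unordered block pairs. -/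
def wExp (i j : Fin m) : ℕ := m * max i.1 j.1 + min i.1 j.1 + 1

/-- the penalty weight `M = 2^{m²+2} > 2·Σ_{i<j} w_{ij}`. -/
def bigM (m : ℕ) : ℝ := 2 ^ (m * m + 2)

/-- ★ **the pairing direction** `C_pair`: as a quadratic form on `b ∈ {0,1}^{2m}`,
`f(b) = Σ_{p,q} C(p,q) b_p b_q = −M Σ_i y_i² + 2 Σ_{i<j} w_{ij} y_i y_j` with `y_i = b_{2i} − b_{2i+1} ∈ {−1,0,1}`:
diagonal `−M`; the within-block off-diagonal cells `+M`; the cross-block cells `± w_{ij}` with the sign `sgn p · sgn q`.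
Valid (`f ≤ 0`), tight exactly on the PAIRED vectors, and — the point — every row has pairwise DISTINCT off-diagonal entries. -/
def pairDir (m : ℕ) : Fin (2 * m) × Fin (2 * m) → ℝ := fun pq =>
  if pq.1 = pq.2 then -bigM m
  else if blk pq.1 = blk pq.2 then bigM m
  else sgn pq.1 * sgn pq.2 * 2 ^ (wExp (blk pq.1) (blk pq.2))

/-- `b` is paired: `b_{2i} = b_{2i+1}` for every block (the vertex set of the contraction face `COR(K_{2m}/M) ≅ COR(K_m)`). -/
def Paired (b : Fin (2 * m) → Bool) : Prop := ∀ i : Fin m, b (ev i) = b (od i)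

/-- **the even read** `ℝ^{2m×2m} → ℝ^{m×m}`, `x ↦ (x_{(2i,2j)})_{(i,j)}` — a coordinate projection; on the pairing face it is a
linear isomorphism onto `COR(K_m)` (it keeps the OFF-diagonal quadratic coordinates, unlike the diagonal read of PROP E). -/
def evenRead (m : ℕ) : (Fin (2 * m) × Fin (2 * m) → ℝ) →ₗ[ℝ] (Fin m × Fin m → ℝ) :=
  LinearMap.funLeft ℝ ℝ (fun ij : Fin m × Fin m => (ev ij.1, ev ij.2))

/-- symmetric and block-constant w.r.t. the pairing: the linear hull `lin F_pair` of the pairing face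
(`= span {corVec ⊤ b − corVec ⊤ b' : b, b' paired}`, dimension `m(m+1)/2`). -/
def BlockConstSym (m : ℕ) (g : Fin (2 * m) × Fin (2 * m) → ℝ) : Prop :=
  (∀ p q, g (p, q) = g (q, p)) ∧ ∀ p q p' q', blk p = blk p' → blk q = blk q' → g (p, q) = g (p', q')

/-! ## First lemmas (statements; the prover's targets, in proof order) -/

/-- L1 — `C_pair` is VALID on `COR(K_{2m})` and TIGHT exactly on the paired vertices. -/
def PairDirFace : Prop :=
  ∀ (m : ℕ) (b : Fin (2 * m) → Bool),
    pairDir m ⬝ᵥ corVec ⊤ b ≤ 0 ∧ (pairDir m ⬝ᵥ corVec ⊤ b = 0 ↔ Paired b)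

/-- L2 — the pairing face READ on the even slots IS `COR(K_m)` (cf. `diagRead_image_cor_face`). -/
def EvenReadFace : Prop :=
  ∀ m : ℕ, evenRead m '' (corPolytopeGraph (⊤ : SimpleGraph (Fin (2 * m))) ∩ {x | pairDir m ⬝ᵥ x = 0}) =
    corPolytopeGraph (⊤ : SimpleGraph (Fin m))

/-- L3 — `C_pair` is GENERIC for `Z_mix(2m)`: nonzero on every (nonzero) generator `E^s_{kl} − E^s_{km}`
(row `k` of `C_pair` has pairwise distinct off-diagonal entries `M, ±w_{blk k, j}`). -/
def PairDirGeneric : Prop :=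
  ∀ (m : ℕ) (g : Fin (2 * m) × Fin (2 * m) × Fin (2 * m)),
    zmixDir (2 * m) g ≠ 0 → pairDir m ⬝ᵥ zmixDir (2 * m) g ≠ 0

/-- L4 — a functional nonzero on every generator of a zonotope exposes a single VERTEX (here for `Z_mix`). -/
def ZmixVertexFace : Prop :=
  ∀ (n : ℕ) (C : Fin n × Fin n → ℝ), (∀ g, zmixDir n g ≠ 0 → C ⬝ᵥ zmixDir n g ≠ 0) →
    Zmix n ∩ {y | C ⬝ᵥ y = C ⬝ᵥ zmixPt n (zmixArgmax C)} = {zmixPt n (zmixArgmax C)}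

/-- ★★ **PROP F — the pairing-face certificate**: an EF of `COR(K_{2m}) + Z_mix(2m)` with `r` inequalities gives one of
`COR(K_m)` with `r` inequalities (L1–L4 + `HasEFOfSize.image_face_add_image_face₁` + translation invariance
`hasEFOfSize_add_singleton`).  With Kaibel–Weltge (`corPolytopeGraph_top_two_pow_half_le`): `xc ≥ 2^{m/2} = 2^{n/4}`. -/
def PairFaceCertificate : Prop :=
  ∀ (m r : ℕ), HasEFOfSize (corPolytopeGraph (⊤ : SimpleGraph (Fin (2 * m))) + Zmix (2 * m)) r →
    HasEFOfSize (corPolytopeGraph (⊤ : SimpleGraph (Fin m))) r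

/-- the line's typed OPEN point (verbatim copy of `Cruxes/NNLinearDegreeCofactorHard/Lines/xc_division.lean` l.1180,
`…XcDivision.ZmixCorExpHard`): `xc(COR(K_n) + Z_mix(n)) ≥ 2^{c·n}` eventually.  TARGET of the card: it follows from
`PairFaceCertificate` (+ the odd case `n = 2m+1`: pin the leftover index with `−M x_{nn}`, or glue it into a block of three). -/
def ZmixCorExpHard : Prop :=
  ∃ c : ℝ, 0 < c ∧ ∃ n₀ : ℕ, ∀ n ≥ n₀, ∀ r : ℕ,
    HasEFOfSize (corPolytopeGraph (⊤ : SimpleGraph (Fin n)) + Zmix n) r → (2 : ℝ) ^ (c * n) ≤ r + 1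

/-- the card's claim, as an implication to be proved. -/
def CardTarget : Prop := PairFaceCertificate → ZmixCorExpHard

/-- ★★ **the Q-uniform law behind PROP F (pairing exposure law)**: if NO difference of two distinct generating points of the
passenger is symmetric-block-constant for the pairing, then `COR(K_{2m}) + Q` is at least as hard as `COR(K_m)`.
(Sharp form: «no EDGE direction of `Q` in `lin F_pair`»; and the same for every perfect matching / switching / root-merge,
i.e. for every contraction-minor face `COR(K_{n+1}/M′)` — the invariant `τ_minor(Q)` of the card.) -/
def PairingExposureLaw : Prop :=
  ∀ (m K : ℕ) (q : Fin (K + 1) → (Fin (2 * m) × Fin (2 * m) → ℝ)) (r : ℕ),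
    (∀ j j', q j ≠ q j' → ¬ BlockConstSym m (q j - q j')) →
    HasEFOfSize (corPolytopeGraph (⊤ : SimpleGraph (Fin (2 * m))) + convexHull ℝ (Set.range q)) r →
      HasEFOfSize (corPolytopeGraph (⊤ : SimpleGraph (Fin m))) r

/-- a zonotope given by a finite generator list: `conv {Σ_g ε_g • gen g : ε ∈ {±1}^G}` (the format of `Zmix`). -/
def zonotopeOf {ι : Type} (G : ℕ) (gen : Fin G → (ι → ℝ)) : Set (ι → ℝ) :=
  convexHull ℝ (Set.range fun ε : Fin G → Bool => ∑ g, (if ε g then (1 : ℝ) else -1) • gen g)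

/-- ★★ **pairing exposure law, zonotope form** (the sharp version for zonotopal passengers: the hypothesis is on GENERATORS = edge
directions, not on vertex differences): if no nonzero generator is symmetric-block-constant for the pairing, `COR(K_{2m}) + Z` is at least as
hard as `COR(K_m)`.  Covers `Z_mix`, `Z_diag`, coordinate boxes, every zonotope with generators supported on `< 4` off-diagonal cells. -/
def PairingExposureLawZonotope : Prop :=
  ∀ (m G : ℕ) (gen : Fin G → (Fin (2 * m) × Fin (2 * m) → ℝ)) (r : ℕ),
    (∀ g, gen g ≠ 0 → ¬ BlockConstSym m (gen g)) →
    HasEFOfSize (corPolytopeGraph (⊤ : SimpleGraph (Fin (2 * m))) + zonotopeOf G gen) r →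
      HasEFOfSize (corPolytopeGraph (⊤ : SimpleGraph (Fin m))) r

/-! ## Cheapest falsifier, run in-Lean at `m = 3` (`n = 6`): an integer mirror of `C_pair`. -/

/-- integer mirror of `pairDir 3` on `Fin 6 × Fin 6`. -/
def pairDirZ : Fin 6 × Fin 6 → ℤ := fun pq =>
  if pq.1 = pq.2 then -(2 ^ 11)
  else if pq.1.1 / 2 = pq.2.1 / 2 then 2 ^ 11
  else (if pq.1.1 % 2 = 0 then 1 else -1) * (if pq.2.1 % 2 = 0 then 1 else -1) *
    2 ^ (3 * max (pq.1.1 / 2) (pq.2.1 / 2) + min (pq.1.1 / 2) (pq.2.1 / 2) + 1)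

/-- the quadratic form `f(b) = Σ_{p,q} C(p,q) b_p b_q`. -/
def fZ (b : Fin 6 → Bool) : ℤ := ∑ p : Fin 6, ∑ q : Fin 6, if b p && b q then pairDirZ (p, q) else 0

/-- L1 at `m = 3`: valid, and tight exactly on the 8 paired vectors. -/
example : ∀ b : Fin 6 → Bool, fZ b ≤ 0 ∧ (fZ b = 0 ↔ ∀ i : Fin 3, b ⟨2 * i.1, by omega⟩ = b ⟨2 * i.1 + 1, by omega⟩) := by
  native_decide

/-- L3 at `m = 3`: every row of `C_pair` has pairwise distinct off-diagonal (symmetrised) entries, i.e. `C_pair` is nonzero on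
every generator `E^s_{kl} − E^s_{km}` of `Z_mix(6)`. -/
example : ∀ k l l' : Fin 6, k ≠ l → k ≠ l' → l ≠ l' →
    pairDirZ (k, l) + pairDirZ (l, k) ≠ pairDirZ (k, l') + pairDirZ (l', k) := by
  native_decide

/-! ### The same two checks at `m = 4` (`n = 8`) and for the ODD variant `n = 7` (leftover index pinned: `C(6,6) = −M`,
`C(6,q) = C(q,6) = 3·2^q`), backing the card's «odd n» clause. -/

/-- generic integer pairing direction on `Fin n` for the blocks `{0,1},{2,3},…` with `mm` blocks, penalty `2^e`, and — when `n` is odd —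
the last index pinned with cross entries `3·2^q`. -/
def pairDirZ' (n mm e : ℕ) : Fin n × Fin n → ℤ := fun pq =>
  if pq.1 = pq.2 then -(2 ^ e)
  else if 2 * mm ≤ pq.1.1 then 3 * 2 ^ pq.2.1
  else if 2 * mm ≤ pq.2.1 then 3 * 2 ^ pq.1.1
  else if pq.1.1 / 2 = pq.2.1 / 2 then 2 ^ e
  else (if pq.1.1 % 2 = 0 then 1 else -1) * (if pq.2.1 % 2 = 0 then 1 else -1) *
    2 ^ (mm * max (pq.1.1 / 2) (pq.2.1 / 2) + min (pq.1.1 / 2) (pq.2.1 / 2) + 1)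

/-- the quadratic form of `pairDirZ'`. -/
def fZ' (n mm e : ℕ) (b : Fin n → Bool) : ℤ := ∑ p : Fin n, ∑ q : Fin n, if b p && b q then pairDirZ' n mm e (p, q) else 0

/-- `m = 4`, `n = 8`, `M = 2^18`: valid, tight exactly on the 16 paired vectors. -/
example : ∀ b : Fin 8 → Bool, fZ' 8 4 18 b ≤ 0 ∧
    (fZ' 8 4 18 b = 0 ↔ ∀ i : Fin 4, b ⟨2 * i.1, by omega⟩ = b ⟨2 * i.1 + 1, by omega⟩) := by
  native_decide

/-- `m = 4`, `n = 8`: row genericity (nonzero on every `Z_mix(8)` generator). -/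
example : ∀ k l l' : Fin 8, k ≠ l → k ≠ l' → l ≠ l' →
    pairDirZ' 8 4 18 (k, l) + pairDirZ' 8 4 18 (l, k) ≠ pairDirZ' 8 4 18 (k, l') + pairDirZ' 8 4 18 (l', k) := by
  native_decide

/-- ODD `n = 7` (`m = 3` blocks + index `6` pinned, `M = 2^11`): valid, tight exactly on «paired ∧ b_6 = false» (face ≅ COR(K_3)). -/
example : ∀ b : Fin 7 → Bool, fZ' 7 3 11 b ≤ 0 ∧
    (fZ' 7 3 11 b = 0 ↔ (∀ i : Fin 3, b ⟨2 * i.1, by omega⟩ = b ⟨2 * i.1 + 1, by omega⟩) ∧ b ⟨6, by omega⟩ = false) := by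
  native_decide

/-- ODD `n = 7`: row genericity (nonzero on every `Z_mix(7)` generator). -/
example : ∀ k l l' : Fin 7, k ≠ l → k ≠ l' → l ≠ l' →
    pairDirZ' 7 3 11 (k, l) + pairDirZ' 7 3 11 (l, k) ≠ pairDirZ' 7 3 11 (k, l') + pairDirZ' 7 3 11 (l', k) := by
  native_decide

/-! ## General contraction flags — crit-9 VERDICT #4 ★ corollary, CHECKED on paper and TYPED here (val-idea-38 g0, 18:5xZ)

For ANY block map `β : Fin n → Fin m` with a section `ρ` (one representative slot per block) the **block direction**
`C₀^β`: diagonal cell `(p,p) ↦ −(#block(p) − 1)`, within-block off-diagonal cells `↦ +1`, cross-block cells `↦ 0`; as a quadratic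
form on `b ∈ {0,1}^n` (ordered-pair coordinates of `corVec ⊤ b`): `f(b) = −Σ_{p<q, β p = β q} (b_p − b_q)²`.  Hence: VALID, tight
exactly on the β-block-constant `b` (the contraction face `F_β ≅ COR(K_m)` under the representative read `x ↦ (x_{(ρ i, ρ j)})`),
and INTEGRAL with `f(b) ≤ −1` off the face — so for 0/1 RANK-ONE TOWERS `Z = Σ_k λ_k [−1,1]·b_k b_kᵀ` no genericity is needed:
`⟨C₀^β, b_k b_kᵀ⟩ = f(b_k)` is `0` iff `b_k` is block-constant (the segment rides along INSIDE the face) and `< 0` otherwise (the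
segment contributes an endpoint).  (For NON-rank-one passengers such as `Z_mix` the cross-block zeros of `C₀^β` are not generic —
`⟨C₀^β, E^s_{kl} − E^s_{km}⟩ = 0` when `l, m ∉ block(k)` — which is why `pairDir` carries the distinct weights `±2^{wExp}`; the
general-`Q` law below uses a generic `C ∈ relint N(F_β)`, available because `span N(F_β) = (lin F_β)^⊥` and
`lin F_β = {symmetric β-block-constant}` (differences of `corVec ⊤ b` over block-constant `b` are such; both have dimension `m(m+1)/2`).)
-/

/-- `b` is constant on every block of `β`. -/
def BlockConst {n m : ℕ} (β : Fin n → Fin m) (b : Fin n → Bool) : Prop := ∀ p q, β p = β q → b p = b q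

instance {n m : ℕ} (β : Fin n → Fin m) (b : Fin n → Bool) : Decidable (BlockConst β b) := by
  unfold BlockConst; infer_instance

/-- the block direction `C₀^β` (crit-9's `C₀^π` with `M = 1`, which suffices: the form is integral). -/
def blockDir {n m : ℕ} (β : Fin n → Fin m) : Fin n × Fin n → ℝ := fun pq =>
  if pq.1 = pq.2 then -(((Finset.univ.filter fun q => β q = β pq.1).card : ℝ) - 1)
  else if β pq.1 = β pq.2 then 1 else 0

/-- the representative read `ℝ^{n×n} → ℝ^{m×m}`, `x ↦ (x_{(ρ i, ρ j)})` (generalises `evenRead`). -/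
def repRead {n m : ℕ} (ρ : Fin m → Fin n) : (Fin n × Fin n → ℝ) →ₗ[ℝ] (Fin m × Fin m → ℝ) :=
  LinearMap.funLeft ℝ ℝ (fun ij : Fin m × Fin m => (ρ ij.1, ρ ij.2))

/-- symmetric and β-block-constant: the linear hull `lin F_β` of the contraction face (generalises `BlockConstSym`). -/
def BlockConstSymGen {n m : ℕ} (β : Fin n → Fin m) (g : Fin n × Fin n → ℝ) : Prop :=
  (∀ p q, g (p, q) = g (q, p)) ∧ ∀ p q p' q', β p = β p' → β q = β q' → g (p, q) = g (p', q')

/-- a 0/1 rank-one TOWER: `Σ_{b : P b} [−1,1] · λ_b · b bᵀ` (note `b bᵀ = corVec ⊤ b` in ordered-pair coordinates). -/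
def tower (h : ℕ) (P : (Fin h → Bool) → Prop) [DecidablePred P] (lam : (Fin h → Bool) → ℝ) : Set (Fin h × Fin h → ℝ) :=
  convexHull ℝ (Set.range fun ε : (Fin h → Bool) → Bool =>
    ∑ b : Fin h → Bool, if P b then ((if ε b then (1 : ℝ) else -1) * lam b) • corVec ⊤ b else 0)

/-- G1 — `C₀^β` is valid on `COR(K_n)`, tight exactly on the block-constant vertices, and ≤ −1 elsewhere (integrality). -/
def BlockDirFace : Prop :=
  ∀ (n m : ℕ) (β : Fin n → Fin m) (b : Fin n → Bool),
    blockDir β ⬝ᵥ corVec ⊤ b ≤ 0 ∧ (blockDir β ⬝ᵥ corVec ⊤ b = 0 ↔ BlockConst β b) ∧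
      (¬ BlockConst β b → blockDir β ⬝ᵥ corVec ⊤ b ≤ -1)

/-- G2 — the contraction face read by representatives IS `COR(K_m)` (needs the section property `β ∘ ρ = id`). -/
def RepReadFace : Prop :=
  ∀ (n m : ℕ) (β : Fin n → Fin m) (ρ : Fin m → Fin n), (∀ t, β (ρ t) = t) →
    repRead ρ '' (corPolytopeGraph (⊤ : SimpleGraph (Fin n)) ∩ {x | blockDir β ⬝ᵥ x = 0}) =
      corPolytopeGraph (⊤ : SimpleGraph (Fin m))

/-- ★★ **TOWER CONTRACTION RUNG** (crit-9 VERDICT #4 corollary = idea-38 ∘ located faces, typed): for every block map with a section and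
every 0/1 rank-one tower, an EF of `COR(K_n) + Z` of size `r` yields one of `COR(K_m) + read(ALIGNED sub-tower)` of size `r`, where the aligned
generators are the block-constant `b` (read to their block patterns `b ∘ ρ`) and all other generators collapse to an endpoint.
Tools: G1, G2, `HasEFOfSize.face_add_face₁` / `image_linearMap` / `hasEFOfSize_add_singleton`.  No genericity, no pairing.
(The aligned generators `b` — block-constant with `P b` — are in bijection with the patterns `a = b ∘ ρ`, `b = a ∘ β`, and
`repRead ρ (corVec ⊤ b) = corVec ⊤ a`.) -/
def TowerContractionRung : Prop :=
  ∀ (n m : ℕ) (β : Fin n → Fin m) (ρ : Fin m → Fin n), (∀ t, β (ρ t) = t) →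
    ∀ (P : (Fin n → Bool) → Prop) [DecidablePred P] (lam : (Fin n → Bool) → ℝ) (r : ℕ),
      HasEFOfSize (corPolytopeGraph (⊤ : SimpleGraph (Fin n)) + tower n P lam) r →
        HasEFOfSize (corPolytopeGraph (⊤ : SimpleGraph (Fin m)) +
          tower m (fun a : Fin m → Bool => P (a ∘ β)) (fun a => lam (a ∘ β))) r

/-- consequence (i) of VERDICT #4, typed: val-idea-42's named target `Z_s := Σ_{|b| = s} [−1,1] b bᵀ` is DECIDED — blocks of size `s`
(`m = ⌊h/s⌋` full blocks, leftovers glued into the last block or pinned): the aligned `b` are single blocks, the read passenger is DIAGONAL,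
and PROP D₀ (`corPolytope_succ_add_diag_three_pow_le`, xc_division.lean rev 4.1) finishes: `xc + 1 ≥ 1.5^{⌊h/s⌋ − 1}`. -/
def ZsHard : Prop :=
  ∀ (s : ℕ), 1 ≤ s → ∀ (h r : ℕ),
    HasEFOfSize (corPolytopeGraph (⊤ : SimpleGraph (Fin h)) +
        tower h (fun b => (Finset.univ.filter fun i => b i = true).card = s) (fun _ => 1)) r →
      (1.5 : ℝ) ^ (h / s - 1 : ℕ) ≤ r + 1

/-- ★★ **CONTRACTION EXPOSURE LAW** (general-`Q`, vertex-difference form; `PairingExposureLaw` is the instance `β = blk`, all blocks of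
size 2): if no difference of two distinct generating points of the passenger is symmetric β-block-constant, then `COR(K_n) + Q` is at least
as hard as `COR(K_m)` (generic `C ∈ relint N(F_β)` exposes `F_β + {vertex}`). -/
def ContractionExposureLaw : Prop :=
  ∀ (n m : ℕ) (β : Fin n → Fin m) (ρ : Fin m → Fin n), (∀ t, β (ρ t) = t) →
    ∀ (K : ℕ) (q : Fin (K + 1) → (Fin n × Fin n → ℝ)) (r : ℕ),
      (∀ j j', q j ≠ q j' → ¬ BlockConstSymGen β (q j - q j')) →
      HasEFOfSize (corPolytopeGraph (⊤ : SimpleGraph (Fin n)) + convexHull ℝ (Set.range q)) r →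
        HasEFOfSize (corPolytopeGraph (⊤ : SimpleGraph (Fin m))) r

/-! ### In-Lean check of G1 on an irregular partition: `n = 7`, blocks `{0,1,2}, {3,4}, {5}, {6}` (sizes 3,2,1,1). -/

/-- block labels of the test partition. -/
def βtest : Fin 7 → Fin 4 := fun p => if p.1 ≤ 2 then 0 else if p.1 ≤ 4 then 1 else if p.1 = 5 then 2 else 3

/-- integer mirror of `blockDir βtest`. -/
def blockDirZ : Fin 7 × Fin 7 → ℤ := fun pq =>
  if pq.1 = pq.2 then -(((Finset.univ.filter fun q => βtest q = βtest pq.1).card : ℤ) - 1)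
  else if βtest pq.1 = βtest pq.2 then 1 else 0

/-- its quadratic form. -/
def gZ (b : Fin 7 → Bool) : ℤ := ∑ p : Fin 7, ∑ q : Fin 7, if b p && b q then blockDirZ (p, q) else 0

/-- G1 at the test partition: valid; tight exactly on the 16 block-constant vectors; ≤ −1 on the other 112. -/
example : ∀ b : Fin 7 → Bool, gZ b ≤ 0 ∧ (gZ b = 0 ↔ BlockConst βtest b) ∧ (¬ BlockConst βtest b → gZ b ≤ -1) := by
  native_decide

/-- the form IS `−Σ_{p<q same block}(b_p − b_q)²` (checked pointwise on all 128 vectors). -/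
example : ∀ b : Fin 7 → Bool, gZ b =
    -∑ p : Fin 7, ∑ q : Fin 7, (if p < q ∧ βtest p = βtest q then ((if b p then (1:ℤ) else 0) - (if b q then 1 else 0)) ^ 2 else 0) := by
  native_decide

/-! ## crit-9 ADVISORY #2 «direction-sparse passengers are decided» — steps 1–3 CHECKED (val-idea-38 g0) and TYPED

CHECK (paper, 18:4xZ): Step 1 ✓ — for `C` generic in `relint N(F_β)` (`span N(F_β) = (lin F_β)^⊥`; the antisymmetric part and
`(aff COR)^⊥` are lineality) every edge `e ⊆ face_C(Q)` has `⟨C, D_e⟩ = 0`, and `{C : ⟨C, D⟩ = 0} ⊉ span N(F_β)` unless `D ∈ lin F_β`, so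
finitely many hyperplanes are avoided at once; NO pinning / equipartition is needed for Step 1 — any block map `β` (arbitrary block sizes)
works, equipartitions enter only in the count.  Typed proxy for «edge directions of Q»: all pairwise differences of the generating points
(a superset ⇒ a weaker but correct law); for zonotopes use the generators (sharp, `PairingExposureLawZonotope` shape).  Step 2 ✓ —
`D ∈ lin F_β` iff `D` is symmetric β-block-constant (diagonal cells included: `D_pp = D_pp′ = D_p′p′` inside a block) iff every block of `β`
lies inside a clone class of `D`; hence with blocks of size `t ≥ 2` every clone class met is a union of blocks (size ≡ 0 mod t), a direction
with an un-cloned index is aligned with no such `β`, and `D = αJ` is aligned with all.  Step 3 ✓ — fraction of `t`-equipartitions of `[h′]`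
refining `κ = (s_i)`, `s_i = u_i t`: `multinomial(m; u) / multinomial(h′; s)`; for `κ = (t, h′−t)` this is `m / C(h′,t)`; two-class
`(ut, h′−ut)` gives `C(m,u)/C(h′,ut)`, decreasing in `u ≤ m/2`, and refining a class multiplies by a ratio `< 1` — so `m / C(h′,t)` IS the
maximum over `κ ≠ {[h′]}` (the one step that wants a careful written proof; verified below by enumeration at `h′ = 4, t = 2`).  Union bound ✓.
A lone aligned `J` leaves a SEGMENT as the read passenger (all edges of `face_C(Q)` parallel to `J`), whence PROP A with `K = 2`: the `/2`.
-/

/-- the all-ones direction `J`. -/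
def Jdir (n : ℕ) : Fin n × Fin n → ℝ := fun _ => 1

/-- ★ **LOCATED-FACE EXPOSURE RUNG, J-tolerant** (ADVISORY #2 Step 1, typed; strengthens `ContractionExposureLaw`): if every symmetric
β-block-constant difference of generating points of the passenger is a multiple of `J`, then an EF of `COR(K_n) + Q` of size `r` gives one of
`COR(K_m) + (segment or point)` of size `r` (then PROP A, `K = 2`: `2(r+1) ≥ 1.5^m`). -/
def LocatedFaceExposureRung : Prop :=
  ∀ (n m : ℕ) (β : Fin n → Fin m) (ρ : Fin m → Fin n), (∀ t, β (ρ t) = t) →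
    ∀ (K : ℕ) (q : Fin (K + 1) → (Fin n × Fin n → ℝ)) (r : ℕ),
      (∀ j j', BlockConstSymGen β (q j - q j') → ∃ α : ℝ, q j - q j' = α • Jdir n) →
      HasEFOfSize (corPolytopeGraph (⊤ : SimpleGraph (Fin n)) + convexHull ℝ (Set.range q)) r →
        ∃ q' : Fin 2 → (Fin m × Fin m → ℝ),
          HasEFOfSize (corPolytopeGraph (⊤ : SimpleGraph (Fin m)) + convexHull ℝ (Set.range q')) r

/-- `β` is a `t`-equipartition: every block has exactly `t` elements. -/
def IsEquipartition {n m : ℕ} (t : ℕ) (β : Fin n → Fin m) : Prop :=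
  ∀ i : Fin m, (Finset.univ.filter fun p => β p = i).card = t

/-- ★ **EQUIPARTITION AVOIDANCE** (ADVISORY #2 Steps 2–3, the pure counting statement): fewer than `C(h′,t)/m` directions, none a multiple of
`J`, are simultaneously NON-aligned for some `t`-equipartition (`h′ = m t`, `t ≥ 2`). -/
def EquipartitionAvoidance : Prop :=
  ∀ (t m : ℕ), 2 ≤ t → ∀ (Ds : Finset (Fin (m * t) × Fin (m * t) → ℝ)),
    Ds.card * m < Nat.choose (m * t) t → (∀ D ∈ Ds, ¬ ∃ α : ℝ, D = α • Jdir (m * t)) →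
      ∃ β : Fin (m * t) → Fin m, IsEquipartition t β ∧ ∀ D ∈ Ds, ¬ BlockConstSymGen β D

/-- ★★ **DIRECTION-SPARSE PASSENGER LAW** (ADVISORY #2 ★, typed with vertex differences as the direction proxy): a passenger on `COR(K_{mt})`
with fewer than `C(mt,t)/m` pairwise-difference directions off `ℝJ` satisfies `xc + 1 ≥ 1.5^m / 2`.  (`= LocatedFaceExposureRung` ∘
`EquipartitionAvoidance` ∘ PROP A.)  Route rate: `m = (log h)^{c+1}`, `t = h/m` tolerates `2^{h/(log h)^{c+2}}` directions. -/
def DirectionSparsePassengerLaw : Prop :=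
  ∀ (t m : ℕ), 2 ≤ t → ∀ (K : ℕ) (q : Fin (K + 1) → (Fin (m * t) × Fin (m * t) → ℝ)) (r : ℕ)
    (Ds : Finset (Fin (m * t) × Fin (m * t) → ℝ)),
    Ds.card * m < Nat.choose (m * t) t →
    (∀ j j', (∃ α : ℝ, q j - q j' = α • Jdir (m * t)) ∨ q j - q j' ∈ Ds) →
    HasEFOfSize (corPolytopeGraph (⊤ : SimpleGraph (Fin (m * t))) + convexHull ℝ (Set.range q)) r →
      (1.5 : ℝ) ^ m ≤ 2 * (r + 1)

/-! ### Step 3 — PROOF PLAN for `EquipartitionAvoidance` (val-idea-40 18:54Z left «the counting half» to 38/42; planner output = plan, not proof)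
Permutation double count, no partition lattice needed.
1. For `D ∈ Ds`: if `D` is not symmetric, `BlockConstSymGen β D` is false for every `β`. Else put `P_D := {p | ∀ q, D (p,q) = D (p₀,q)}`
   (`p₀` any index). `BlockConstSymGen β D → ∀ i, β⁻¹ i ⊆ P_D ∨ β⁻¹ i ∩ P_D = ∅` (block-constancy with `q' = q`), i.e. `P_D` is a union of
   `β`-blocks; and `P_D ≠ univ` (all rows equal + symmetry ⇒ `D` constant ⇒ `D = D(p₀,p₀) • Jdir`, excluded).
2. Fix the reference equipartition `β₀ p := p / t` and range over `σ : Equiv.Perm (Fin (m t))`, `β := β₀ ∘ σ` (an equipartition for every `σ`).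
   Blocks of `β₀ ∘ σ` are `σ⁻¹(B_i)`; `P` is a union of them iff `σ '' P` is a union of `β₀`-blocks.  By transitivity
   `#{σ | σ '' P = S} = |P|! (mt − |P|)!` for every `S` with `|S| = |P|`, and `#{S | |S| = k t, S a union of β₀-blocks} = C(m,k)`
   (`0` if `t ∤ |P|`).  Hence `#BAD_D ≤ max_{1 ≤ k ≤ m−1} C(m,k) (kt)! ((m−k)t)!`.
3. `EquipartitionCountIneq` below: `C(m,k) (kt)! ((m−k)t)! ≤ m · t! · ((m−1)t)!` for `1 ≤ k ≤ m−1` (proof: `g(k) = g(m−k)`, and for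
   `2k ≤ m+1`, `g(k)/g(k−1) = ∏_{j=1}^{t−1} ((k−1)t + j)/((m−k)t + j) ≤ 1` — the `j = t` factor `k/(m−k+1)` cancels `C(m,k)/C(m,k−1)`;
   checked exactly for `t ≤ 7, m ≤ 15` off-line and by `native_decide` below for `m ≤ 6, t ≤ 3`).
4. Union bound in `ℕ` (no division): `Σ_D #BAD_D ≤ |Ds| · m · t! ((m−1)t)! < C(mt,t) · t! (mt−t)! = (mt)! = #Perm`, using the hypothesis
   `|Ds| · m < C(mt,t)`; so some `σ` lies in no `BAD_D`, and `β₀ ∘ σ` is the wanted equipartition.  (Degenerate `m t = 0`: the hypothesis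
   `|Ds| · m < C(0,t) = 0` is false.)  Mathlib: `Equiv.Perm`, `Fintype.card_perm`, `Finset.card_biUnion_le`, `Nat.choose_mul_factorial_mul_factorial`. -/

/-- the pure binomial inequality of Step 3 (3.): the `(m−1,1)` split is extremal. -/
def EquipartitionCountIneq : Prop :=
  ∀ m t k : ℕ, 1 ≤ t → 1 ≤ k → k < m →
    Nat.choose m k * Nat.factorial (k * t) * Nat.factorial ((m - k) * t) ≤ m * Nat.factorial t * Nat.factorial ((m - 1) * t)

example : ∀ m ∈ Finset.range 7, ∀ t ∈ Finset.range 4, ∀ k ∈ Finset.range 7, 1 ≤ t → 1 ≤ k → k < m →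
    Nat.choose m k * Nat.factorial (k * t) * Nat.factorial ((m - k) * t) ≤ m * Nat.factorial t * Nat.factorial ((m - 1) * t) := by
  native_decide

/-- negative control for the direction of the inequality: it is STRICT already at `m = 4, t = 2, k = 2` (`6·24·24 = 3456 < 4·2·720 = 5760`)
and FALSE with `t` and `k t` swapped naively — the checks above are not vacuous. -/
example : Nat.choose 4 2 * Nat.factorial (2 * 2) * Nat.factorial ((4 - 2) * 2) < 4 * Nat.factorial 2 * Nat.factorial ((4 - 1) * 2) := by
  native_decide

/-! ### In-Lean check of Step 3's extremal count at `h′ = 4, t = 2` (`m = 2`, `C(4,2)/m = 3` pairings in all; claim: a partition `κ ≠ {[4]}`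
is refined by at most `m/C(h′,t) · 3 = 1` perfect matching).  Partitions `κ` as label maps `Fin 4 → Fin 4`, matchings as fixed-point-free
involutions. -/

example : ∀ κ : Fin 4 → Fin 4, (∃ p q, κ p ≠ κ q) →
    (Finset.univ.filter fun σ : Fin 4 → Fin 4 =>
      (∀ p, σ (σ p) = p) ∧ (∀ p, σ p ≠ p) ∧ ∀ p, κ (σ p) = κ p).card ≤ 1 := by
  native_decide

/-- and the total number of perfect matchings of `[4]` in this encoding is `3 = C(4,2)/2`. -/
example : (Finset.univ.filter fun σ : Fin 4 → Fin 4 => (∀ p, σ (σ p) = p) ∧ ∀ p, σ p ≠ p).card = 3 := by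
  native_decide

end Summit.ValiantsHypothesis.ValiantsHypothesis.Cruxes.NNDivisionHard.PairFace

end
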